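import Literature.Combinatorics.Optimization.ShellLawFullEdgeMoments
import Literature.Combinatorics.Optimization.TypeSortedQuadraticForms
import HarnessLib

/-!
# Pinned shell sums depend on the pinned edges only through their `H`-types; the containment form of a
# general direction over the edges of the ground set

Cell pnp-psdrank (literature seat g40), companion of `TypeSortedQuadraticForms` (the algebra of forms exchangeable within
types) for the step «(CG_1′) for `H`-symmetric masks in EVERY direction» (prover MEMO-25 §2, MEMO-32 §3, brick 145a).
Setting: a fixed-point-free involution `π` on `Fin n` (the partner map of a perfect matching), a `π`-stable ground set
`S`, a block `H`, the shells `Shell_S(t,c)` of cuts `U ⊆ S` with `|U| = t` and `c` half-matched vertices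
[Rothvoss2017, §2]. The `H`-TYPE of the edge `e_r = {r, πr}` at a vertex `r` is `|e_r ∩ H| ∈ {0,1,2}` (`H̄H̄`, mixed, `HH`).
* §1 fiberwise shell sums (`sum_shellIn_eq_sum_mul_shellCount`) and **`sum_shellIn_eq_of_types_eq`**: a shell sum of a
  function of the block statistic depends on `(S, H)` only through the three type counts (`shellCount_eq_of_types_eq'`);
* §2 the type counts of an edge-deleted ground set `S ∖ e_r` are those of `S` minus `(2·[HH], [mixed], 2·[H̄H̄])` of the
  deleted edge (`card_vAA_sdiff_pair_add`, `card_vBH_sdiff_pair_add`, `card_vDD_sdiff_pair_add`), so they depend on `r` only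
  through `|e_r ∩ H|` (`types_sdiff_pair_eq_of_type_eq`);
* §3 **`sum_shell_pinOne_eq_of_type`**: the one-edge pinned sum `Σ_{U ∈ Shell_S(t,c), e_r ⊆ U} ψ(|U∩H|)` depends on `r ∈ S`
  only through `|e_r ∩ H|` (`sum_shell_pin_one_eq` moves it to `S ∖ e_r`, then §1–§2);
* §4 **`sum_shell_pinTwo_eq_of_types`**: the two-edge pinned sum `Σ_{U ∈ Shell_S(t,c), e_r ∪ e_q ⊆ U} ψ(|U∩H|)` (`e_r ≠ e_q`)
  depends on `(r, q)` only through `(|e_r ∩ H|, |e_q ∩ H|)` (`sum_shell_pin_two_eq` on `del2`, then §1–§2 twice);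
* §5 the PINNED PAIR MATRIX on the representatives `E = reps_π(S)` of the edges,
  `A(r,q) = Σ_{c} ω_c Σ_{U ∈ Shell_S(t,c)} ψ(|U∩H|)·[e_r ⊆ U]·[e_q ⊆ U]`, is EXCHANGEABLE WITHIN `H`-TYPES
  (**`pinMatrix_diag_eq_of_type`**, **`pinMatrix_offDiag_eq_of_types`**) — literally the two hypotheses of
  `TypeSortedForm.sum_sum_mul_mul_le_typeAvg_add_of_exchangeable` with `τ r = |e_r ∩ H|`;
* §6 the BRIDGE to the cell's containment form: `Σ_{p ∈ S} c_p·x_p x_{πp} = Σ_{r ∈ reps_π(S)} (c_r + c_{πr})·[e_r ⊆ U]`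
  (`sum_containment_eq_sum_reps`) and `Σ_U ω(U)·(Σ_r v_r [e_r ⊆ U])² = Σ_{r,q} v_r v_q·Σ_U ω(U)[e_r ⊆ U][e_q ⊆ U]`
  (`sum_mul_sq_sum_eq_sum_sum_pinMatrix`), hence `shellForm_eq_sum_sum_pinMatrix`;
* §7 **`shellForm_le_typeAvg_add`** — THE BOX-SUP REDUCTION IN SHELL CURRENCY: for vertex weights `c` with edge weights
  `|c_r + c_{πr}| ≤ L` and any bound `D_a ≥ A(r,r) − A(r,r')` over distinct same-type representatives `r ≠ r'` (`0 ≤ D_a`,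
  `a ∈ {0,1,2}`), the weighted shell sum of `ψ(|U∩H|)(Σ_p c_p x_p x_{πp})²` is at most the same sum at the TYPE-CONSTANT vertex
  direction `c̄_p = v̄_{|e_p∩H|}/2` (`v̄_a` = the average edge weight of type `a`, `|c̄_p| ≤ L/2`) plus `L²·Σ_a m_a·D_a`
  (`m_a` = number of edges of `S` of type `a`) — `TypeSortedForm.sum_sum_mul_mul_le_typeAvg_add_of_exchangeable` ∘ §5 ∘ §6.
All PROVED; no definitions, no named facts; pure finite combinatorics (no constants).

## References
* [Rothvoss2017] T. Rothvoß, *The matching polytope has exponential extension complexity*, J. ACM 64 (2017), §2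
  (PDF pp. 5–6): cuts `U`, perfect matchings, the edges inside / crossing a cut, the three edge types of a block.
* [GodsilMeagher2015] C. Godsil, K. Meagher, *Erdős–Ko–Rado Theorems: Algebraic Approaches*, CUP, §15.2 (perfect matchings
  as fixed-point-free involutions; representatives of edges) and §2.2 (orbit partitions are equitable: the symmetry behind
  the exchangeability of the pinned pair matrix).
-/

noncomputable section

open Finset

namespace Literature.Combinatorics.Optimization

namespace ShellStep

variable {n : ℕ} {π : Fin n → Fin n} (hπ : ∀ v, π (π v) = v) (hπ' : ∀ v, π v ≠ v)
include hπ hπ'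

/-! ### §1 Shell sums of a function of the block statistic are determined by the type counts -/

omit hπ hπ' in
/-- **Fiberwise shell sum**: `Σ_{U ∈ Shell_S(t,c)} g(|U ∩ H|) = Σ_{x=0}^{t} g(x)·Sh_S(t,c;x)`.
[cite: Rothvoss2017, §2 (PDF p. 6)] -/
theorem sum_shellIn_eq_sum_mul_shellCount (S H : Finset (Fin n)) (t c : ℕ) (g : ℤ → ℝ) :
    ∑ U ∈ shellIn π S t c, g ((U ∩ H).card : ℤ) = ∑ x ∈ Icc (0 : ℤ) t, g x * shellCount π S H t c x := by
  have hmaps : ∀ U ∈ shellIn π S t c, ((U ∩ H).card : ℤ) ∈ Icc (0 : ℤ) t := by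
    intro U hU
    rw [mem_Icc]
    refine ⟨by positivity, ?_⟩
    have h1 : (U ∩ H).card ≤ U.card := card_le_card inter_subset_left
    have h2 : U.card = t := (mem_shellIn.1 hU).2.1
    exact_mod_cast h2 ▸ h1
  rw [← sum_fiberwise_of_maps_to hmaps]
  refine sum_congr rfl fun x _ => ?_
  rw [shellCount, mul_comm, ← nsmul_eq_mul, ← sum_const]
  exact sum_congr rfl fun U hU => by rw [(mem_filter.1 hU).2]

/-- **Shell sums are determined by the type counts.** For `π`-stable ground sets `S₁, S₂` and blocks `H₁, H₂` with the
same numbers of `HH`, mixed and `H̄H̄` vertices, `Σ_{U ∈ Shell_{S₁}(t,c)} g(|U ∩ H₁|) = Σ_{U ∈ Shell_{S₂}(t,c)} g(|U ∩ H₂|)` for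
every `g`, `t`, `c` (`ShellLawTypeStep.shellCount_eq_of_types_eq'` atom by atom). [cite: Rothvoss2017, §2 (PDF pp. 5–6)] -/
theorem sum_shellIn_eq_of_types_eq {S₁ S₂ H₁ H₂ : Finset (Fin n)} (hS₁ : ∀ v ∈ S₁, π v ∈ S₁)
    (hS₂ : ∀ v ∈ S₂, π v ∈ S₂) (hAA : (vAA π S₁ H₁).card = (vAA π S₂ H₂).card)
    (hBH : (vBH π S₁ H₁).card = (vBH π S₂ H₂).card) (hDD : (vDD π S₁ H₁).card = (vDD π S₂ H₂).card)
    (t c : ℕ) (g : ℤ → ℝ) :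
    ∑ U ∈ shellIn π S₁ t c, g ((U ∩ H₁).card : ℤ) = ∑ U ∈ shellIn π S₂ t c, g ((U ∩ H₂).card : ℤ) := by
  rw [sum_shellIn_eq_sum_mul_shellCount S₁ H₁ t c g, sum_shellIn_eq_sum_mul_shellCount S₂ H₂ t c g]
  exact sum_congr rfl fun x _ => by rw [shellCount_eq_of_types_eq' hπ hπ' hS₁ hS₂ hAA hBH hDD t c x]

/-! ### §2 The type counts of an edge-deleted ground set -/

omit hπ in
/-- The `H`-type of the edge at `v` as a number: `|{v, πv} ∩ H| = [v ∈ H] + [πv ∈ H]`. [cite: Rothvoss2017, §2 (PDF p. 5)] -/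
theorem card_pair_inter_eq_ite (H : Finset (Fin n)) (v : Fin n) :
    ({v, π v} ∩ H).card = (if v ∈ H then 1 else 0) + (if π v ∈ H then 1 else 0) := by
  have hne : v ≠ π v := (hπ' v).symm
  by_cases h1 : v ∈ H <;> by_cases h2 : π v ∈ H
  · rw [insert_inter_of_mem h1, singleton_inter_of_mem h2, card_pair hne, if_pos h1, if_pos h2]
  · rw [insert_inter_of_mem h1, singleton_inter_of_notMem h2, insert_empty, card_singleton, if_pos h1, if_neg h2]
  · rw [insert_inter_of_notMem h1, singleton_inter_of_mem h2, card_singleton, if_neg h1, if_pos h2]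
  · rw [insert_inter_of_notMem h1, singleton_inter_of_notMem h2, card_empty, if_neg h1, if_neg h2]

omit hπ hπ' in
/-- Deleting a vertex set from the ground set deletes it from each type class. [cite: Rothvoss2017, §2 (PDF p. 5)] -/
theorem vAA_sdiff_eq (S H P : Finset (Fin n)) : vAA π (S \ P) H = vAA π S H \ P := by
  ext u; simp only [mem_vAA, mem_sdiff]; tauto

omit hπ hπ' in
/-- Deleting a vertex set from the ground set deletes it from each type class. [cite: Rothvoss2017, §2 (PDF p. 5)] -/
theorem vBH_sdiff_eq (S H P : Finset (Fin n)) : vBH π (S \ P) H = vBH π S H \ P := by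
  ext u; simp only [mem_vBH, mem_sdiff]; tauto

omit hπ hπ' in
/-- Deleting a vertex set from the ground set deletes it from each type class. [cite: Rothvoss2017, §2 (PDF p. 5)] -/
theorem vDD_sdiff_eq (S H P : Finset (Fin n)) : vDD π (S \ P) H = vDD π S H \ P := by
  ext u; simp only [mem_vDD, mem_sdiff]; tauto

/-- **`HH` count after deleting the edge at `v ∈ S`**: `|vAA(S ∖ e_v)| + 2·[|e_v ∩ H| = 2] = |vAA(S)|`.
[cite: Rothvoss2017, §2 (PDF p. 5)] -/
theorem card_vAA_sdiff_pair_add {S : Finset (Fin n)} (hS : ∀ u ∈ S, π u ∈ S) (H : Finset (Fin n)) {v : Fin n}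
    (hv : v ∈ S) :
    (vAA π (S \ {v, π v}) H).card + (if ({v, π v} ∩ H).card = 2 then 2 else 0) = (vAA π S H).card := by
  have hne : v ≠ π v := (hπ' v).symm
  rw [vAA_sdiff_eq, card_pair_inter_eq_ite hπ' H v]
  have key : vAA π S H \ {v, π v} = vAA π S H \ (vAA π S H ∩ {v, π v}) := by rw [sdiff_inter_self_left]
  rw [key, card_sdiff_of_subset inter_subset_left]
  by_cases h1 : v ∈ H <;> by_cases h2 : π v ∈ H
  · have hint : vAA π S H ∩ {v, π v} = {v, π v} := by
      refine inter_eq_right.2 fun u hu => ?_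
      rcases mem_insert.1 hu with rfl | hu
      · exact mem_vAA.2 ⟨hv, h1, h2⟩
      · rw [mem_singleton] at hu; subst hu; exact mem_vAA.2 ⟨hS _ hv, h2, by rwa [hπ]⟩
    rw [hint, card_pair hne, if_pos h1, if_pos h2, if_pos rfl]
    have : 2 ≤ (vAA π S H).card := by
      rw [← card_pair hne, ← hint]; exact card_le_card inter_subset_left
    omega
  · have hint : vAA π S H ∩ {v, π v} = ∅ := by
      refine eq_empty_iff_forall_notMem.2 fun u hu => ?_
      rw [mem_inter, mem_vAA, mem_insert, mem_singleton] at hu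
      rcases hu with ⟨⟨-, huH, hπuH⟩, rfl | rfl⟩
      · exact h2 hπuH
      · exact h2 huH
    rw [hint, card_empty, if_pos h1, if_neg h2]; simp
  · have hint : vAA π S H ∩ {v, π v} = ∅ := by
      refine eq_empty_iff_forall_notMem.2 fun u hu => ?_
      rw [mem_inter, mem_vAA, mem_insert, mem_singleton] at hu
      rcases hu with ⟨⟨-, huH, hπuH⟩, rfl | rfl⟩
      · exact h1 huH
      · rw [hπ] at hπuH; exact h1 hπuH
    rw [hint, card_empty, if_neg h1, if_pos h2]; simp
  · have hint : vAA π S H ∩ {v, π v} = ∅ := by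
      refine eq_empty_iff_forall_notMem.2 fun u hu => ?_
      rw [mem_inter, mem_vAA, mem_insert, mem_singleton] at hu
      rcases hu with ⟨⟨-, huH, hπuH⟩, rfl | rfl⟩
      · exact h1 huH
      · exact h2 huH
    rw [hint, card_empty, if_neg h1, if_neg h2]; simp

/-- **Mixed count after deleting the edge at `v ∈ S`** (counted by the `H`-endpoints): `|vBH(S ∖ e_v)| + [|e_v ∩ H| = 1] = |vBH(S)|`.
[cite: Rothvoss2017, §2 (PDF p. 5)] -/
theorem card_vBH_sdiff_pair_add {S : Finset (Fin n)} (hS : ∀ u ∈ S, π u ∈ S) (H : Finset (Fin n)) {v : Fin n}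
    (hv : v ∈ S) :
    (vBH π (S \ {v, π v}) H).card + (if ({v, π v} ∩ H).card = 1 then 1 else 0) = (vBH π S H).card := by
  have hne : v ≠ π v := (hπ' v).symm
  rw [vBH_sdiff_eq, card_pair_inter_eq_ite hπ' H v]
  have key : vBH π S H \ {v, π v} = vBH π S H \ (vBH π S H ∩ {v, π v}) := by rw [sdiff_inter_self_left]
  rw [key, card_sdiff_of_subset inter_subset_left]
  by_cases h1 : v ∈ H <;> by_cases h2 : π v ∈ H
  · have hint : vBH π S H ∩ {v, π v} = ∅ := by
      refine eq_empty_iff_forall_notMem.2 fun u hu => ?_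
      rw [mem_inter, mem_vBH, mem_insert, mem_singleton] at hu
      rcases hu with ⟨⟨-, huH, hπuH⟩, rfl | rfl⟩
      · exact hπuH h2
      · rw [hπ] at hπuH; exact hπuH h1
    rw [hint, card_empty, if_pos h1, if_pos h2]; simp
  · have hint : vBH π S H ∩ {v, π v} = {v} := by
      ext u
      simp only [mem_inter, mem_vBH, mem_insert, mem_singleton]
      constructor
      · rintro ⟨⟨-, huH, hπuH⟩, rfl | rfl⟩
        · rfl
        · exact absurd huH h2
      · rintro rfl; exact ⟨⟨hv, h1, h2⟩, Or.inl rfl⟩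
    rw [hint, card_singleton, if_pos h1, if_neg h2]
    have : 1 ≤ (vBH π S H).card := by
      rw [← card_singleton v, ← hint]; exact card_le_card inter_subset_left
    simp only [add_zero, if_true]
    omega
  · have hint : vBH π S H ∩ {v, π v} = {π v} := by
      ext u
      simp only [mem_inter, mem_vBH, mem_insert, mem_singleton]
      constructor
      · rintro ⟨⟨-, huH, hπuH⟩, rfl | rfl⟩
        · exact absurd huH h1
        · rfl
      · rintro rfl; exact ⟨⟨hS _ hv, h2, by rwa [hπ]⟩, Or.inr rfl⟩
    rw [hint, card_singleton, if_neg h1, if_pos h2]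
    have : 1 ≤ (vBH π S H).card := by
      rw [← card_singleton (π v), ← hint]; exact card_le_card inter_subset_left
    simp only [zero_add, if_true]
    omega
  · have hint : vBH π S H ∩ {v, π v} = ∅ := by
      refine eq_empty_iff_forall_notMem.2 fun u hu => ?_
      rw [mem_inter, mem_vBH, mem_insert, mem_singleton] at hu
      rcases hu with ⟨⟨-, huH, hπuH⟩, rfl | rfl⟩
      · exact h1 huH
      · exact h2 huH
    rw [hint, card_empty, if_neg h1, if_neg h2]; simp

/-- **`H̄H̄` count after deleting the edge at `v ∈ S`**: `|vDD(S ∖ e_v)| + 2·[|e_v ∩ H| = 0] = |vDD(S)|`.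
[cite: Rothvoss2017, §2 (PDF p. 5)] -/
theorem card_vDD_sdiff_pair_add {S : Finset (Fin n)} (hS : ∀ u ∈ S, π u ∈ S) (H : Finset (Fin n)) {v : Fin n}
    (hv : v ∈ S) :
    (vDD π (S \ {v, π v}) H).card + (if ({v, π v} ∩ H).card = 0 then 2 else 0) = (vDD π S H).card := by
  have hne : v ≠ π v := (hπ' v).symm
  rw [vDD_sdiff_eq, card_pair_inter_eq_ite hπ' H v]
  have key : vDD π S H \ {v, π v} = vDD π S H \ (vDD π S H ∩ {v, π v}) := by rw [sdiff_inter_self_left]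
  rw [key, card_sdiff_of_subset inter_subset_left]
  by_cases h1 : v ∈ H <;> by_cases h2 : π v ∈ H
  · have hint : vDD π S H ∩ {v, π v} = ∅ := by
      refine eq_empty_iff_forall_notMem.2 fun u hu => ?_
      rw [mem_inter, mem_vDD, mem_insert, mem_singleton] at hu
      rcases hu with ⟨⟨-, huH, hπuH⟩, rfl | rfl⟩
      · exact huH h1
      · exact huH h2
    rw [hint, card_empty, if_pos h1, if_pos h2]; simp
  · have hint : vDD π S H ∩ {v, π v} = ∅ := by
      refine eq_empty_iff_forall_notMem.2 fun u hu => ?_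
      rw [mem_inter, mem_vDD, mem_insert, mem_singleton] at hu
      rcases hu with ⟨⟨-, huH, hπuH⟩, rfl | rfl⟩
      · exact huH h1
      · rw [hπ] at hπuH; exact hπuH h1
    rw [hint, card_empty, if_pos h1, if_neg h2]; simp
  · have hint : vDD π S H ∩ {v, π v} = ∅ := by
      refine eq_empty_iff_forall_notMem.2 fun u hu => ?_
      rw [mem_inter, mem_vDD, mem_insert, mem_singleton] at hu
      rcases hu with ⟨⟨-, huH, hπuH⟩, rfl | rfl⟩
      · exact hπuH h2
      · exact huH h2
    rw [hint, card_empty, if_neg h1, if_pos h2]; simp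
  · have hint : vDD π S H ∩ {v, π v} = {v, π v} := by
      refine inter_eq_right.2 fun u hu => ?_
      rcases mem_insert.1 hu with rfl | hu
      · exact mem_vDD.2 ⟨hv, h1, h2⟩
      · rw [mem_singleton] at hu; subst hu; exact mem_vDD.2 ⟨hS _ hv, h2, by rwa [hπ]⟩
    rw [hint, card_pair hne, if_neg h1, if_neg h2, if_pos rfl]
    have : 2 ≤ (vDD π S H).card := by
      rw [← card_pair hne, ← hint]; exact card_le_card inter_subset_left
    omega

/-- **The type counts of `S ∖ e_v` depend on `v` only through `|e_v ∩ H|`**: for `v, v' ∈ S` with `|e_v ∩ H| = |e_{v'} ∩ H|`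
the ground sets `S ∖ e_v`, `S ∖ e_{v'}` have the same numbers of `HH`, mixed and `H̄H̄` vertices.
[cite: Rothvoss2017, §2 (PDF p. 5)] -/
theorem types_sdiff_pair_eq_of_type_eq {S : Finset (Fin n)} (hS : ∀ u ∈ S, π u ∈ S) (H : Finset (Fin n))
    {v v' : Fin n} (hv : v ∈ S) (hv' : v' ∈ S) (hσ : ({v, π v} ∩ H).card = ({v', π v'} ∩ H).card) :
    (vAA π (S \ {v, π v}) H).card = (vAA π (S \ {v', π v'}) H).card ∧
      (vBH π (S \ {v, π v}) H).card = (vBH π (S \ {v', π v'}) H).card ∧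
        (vDD π (S \ {v, π v}) H).card = (vDD π (S \ {v', π v'}) H).card := by
  have hA := card_vAA_sdiff_pair_add hπ hπ' hS H hv
  have hA' := card_vAA_sdiff_pair_add hπ hπ' hS H hv'
  have hB := card_vBH_sdiff_pair_add hπ hπ' hS H hv
  have hB' := card_vBH_sdiff_pair_add hπ hπ' hS H hv'
  have hD := card_vDD_sdiff_pair_add hπ hπ' hS H hv
  have hD' := card_vDD_sdiff_pair_add hπ hπ' hS H hv'
  rw [hσ] at hA hB hD
  refine ⟨?_, ?_, ?_⟩ <;> omega

/-! ### §3 The one-edge pinned sum depends on the edge only through its type -/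

omit hπ in
/-- A cut containing a whole edge has at least two vertices. [cite: Rothvoss2017, §2 (PDF p. 5)] -/
theorem two_le_card_of_pair_subset {U : Finset (Fin n)} {v : Fin n} (hv : v ∈ U) (hπv : π v ∈ U) : 2 ≤ U.card := by
  have hne : v ≠ π v := (hπ' v).symm
  calc 2 = ({v, π v} : Finset (Fin n)).card := (card_pair hne).symm
    _ ≤ U.card := card_le_card (by
        intro u hu
        rcases mem_insert.1 hu with rfl | hu
        · exact hv
        · rw [mem_singleton] at hu; subst hu; exact hπv)

/-- **ONE-EDGE PINNED SHELL SUMS ARE TYPE FUNCTIONS.** For a `π`-stable `S`, `v, v' ∈ S` with `|e_v ∩ H| = |e_{v'} ∩ H|`, and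
every `ψ`, `t`, `c`: `Σ_{U ∈ Shell_S(t,c), e_v ⊆ U} ψ(|U∩H|) = Σ_{U ∈ Shell_S(t,c), e_{v'} ⊆ U} ψ(|U∩H|)`. (Pin-one moves each
side to the edge-deleted ground set, `sum_shell_pin_one_eq`, whose type counts depend only on the type of the deleted edge.)
[cite: Rothvoss2017, §2 (PDF pp. 5–6)] -/
theorem sum_shell_pinOne_eq_of_type {S : Finset (Fin n)} (hS : ∀ u ∈ S, π u ∈ S) (H : Finset (Fin n))
    {v v' : Fin n} (hv : v ∈ S) (hv' : v' ∈ S) (hσ : ({v, π v} ∩ H).card = ({v', π v'} ∩ H).card)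
    (t c : ℕ) (ψ : ℤ → ℝ) :
    ∑ U ∈ (shellIn π S t c).filter (fun U => v ∈ U ∧ π v ∈ U), ψ ((U ∩ H).card : ℤ) =
      ∑ U ∈ (shellIn π S t c).filter (fun U => v' ∈ U ∧ π v' ∈ U), ψ ((U ∩ H).card : ℤ) := by
  rcases Nat.lt_or_ge t 2 with ht | ht
  · -- no cut of size `< 2` contains an edge
    have hempty : ∀ w : Fin n, (shellIn π S t c).filter (fun U => w ∈ U ∧ π w ∈ U) = ∅ := by
      intro w
      refine filter_eq_empty_iff.2 fun U hU hw => ?_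
      have h2 := two_le_card_of_pair_subset hπ' hw.1 hw.2
      rw [(mem_shellIn.1 hU).2.1] at h2
      omega
    rw [hempty v, hempty v', sum_empty]
  · obtain ⟨t', rfl⟩ := Nat.exists_eq_add_of_le' ht
    rw [sum_shell_pin_one_eq hπ hπ' hS H hv t' c ψ, sum_shell_pin_one_eq hπ hπ' hS H hv' t' c ψ, hσ]
    obtain ⟨hA, hB, hD⟩ := types_sdiff_pair_eq_of_type_eq hπ hπ' hS H hv hv' hσ
    exact sum_shellIn_eq_of_types_eq hπ hπ' (sdiff_pair_stable hπ hS v) (sdiff_pair_stable hπ hS v') hA hB hD t' c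
      (fun x => ψ (x + (({v', π v'} ∩ H).card : ℤ)))

/-! ### §4 The two-edge pinned sum depends on the two edges only through their types -/

/-- A cut containing two different whole edges has at least four vertices. [cite: Rothvoss2017, §2 (PDF p. 5)] -/
theorem four_le_card_of_two_pairs_subset {U : Finset (Fin n)} {v w : Fin n} (hwv : w ≠ v) (hwπ : w ≠ π v)
    (hv : v ∈ U) (hπv : π v ∈ U) (hw : w ∈ U) (hπw : π w ∈ U) : 4 ≤ U.card := by
  have h1 : v ≠ π v := (hπ' v).symm
  have h2 : w ≠ π w := (hπ' w).symm
  have h3 : π w ≠ v := fun e => hwπ (by rw [← e, hπ])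
  have h4 : π w ≠ π v := fun e => hwv (π_injective hπ e)
  have hdisj : Disjoint ({v, π v} : Finset (Fin n)) {w, π w} := by
    rw [disjoint_left]
    intro u hu hu'
    simp only [mem_insert, mem_singleton] at hu hu'
    rcases hu with hu | hu <;> rcases hu' with e | e
    · exact hwv (e.symm.trans hu).symm.symm
    · exact h3 (e.symm.trans hu)
    · exact hwπ (e.symm.trans hu)
    · exact h4 (e.symm.trans hu)
  have hsub : ({v, π v} : Finset (Fin n)) ∪ {w, π w} ⊆ U := by
    intro u hu
    simp only [mem_union, mem_insert, mem_singleton] at hu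
    rcases hu with (rfl | rfl) | (rfl | rfl) <;> assumption
  calc 4 = (({v, π v} : Finset (Fin n)) ∪ {w, π w}).card := by
        rw [card_union_of_disjoint hdisj, card_pair h1, card_pair h2]
    _ ≤ U.card := card_le_card hsub

/-- **TWO-EDGE PINNED SHELL SUMS ARE TYPE FUNCTIONS.** For a `π`-stable `S`, two different edges `e_v ≠ e_w` and two
different edges `e_{v'} ≠ e_{w'}` of `S` with `|e_v ∩ H| = |e_{v'} ∩ H|`, `|e_w ∩ H| = |e_{w'} ∩ H|`, and every `ψ`, `t`, `c`:
`Σ_{U ∈ Shell_S(t,c), e_v ∪ e_w ⊆ U} ψ(|U∩H|) = Σ_{U ∈ Shell_S(t,c), e_{v'} ∪ e_{w'} ⊆ U} ψ(|U∩H|)` (pin-two moves each side to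
`del2`, `sum_shell_pin_two_eq`; its type counts depend only on the two deleted types). [cite: Rothvoss2017, §2 (PDF pp. 5–6)] -/
theorem sum_shell_pinTwo_eq_of_types {S : Finset (Fin n)} (hS : ∀ u ∈ S, π u ∈ S) (H : Finset (Fin n))
    {v w v' w' : Fin n} (hv : v ∈ S) (hw : w ∈ S) (hwv : w ≠ v) (hwπ : w ≠ π v)
    (hv' : v' ∈ S) (hw' : w' ∈ S) (hwv' : w' ≠ v') (hwπ' : w' ≠ π v')
    (hσv : ({v, π v} ∩ H).card = ({v', π v'} ∩ H).card) (hσw : ({w, π w} ∩ H).card = ({w', π w'} ∩ H).card)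
    (t c : ℕ) (ψ : ℤ → ℝ) :
    ∑ U ∈ (shellIn π S t c).filter (fun U => v ∈ U ∧ π v ∈ U ∧ w ∈ U ∧ π w ∈ U), ψ ((U ∩ H).card : ℤ) =
      ∑ U ∈ (shellIn π S t c).filter (fun U => v' ∈ U ∧ π v' ∈ U ∧ w' ∈ U ∧ π w' ∈ U), ψ ((U ∩ H).card : ℤ) := by
  rcases Nat.lt_or_ge t 4 with ht | ht
  · have hempty : ∀ a b : Fin n, b ≠ a → b ≠ π a →
        (shellIn π S t c).filter (fun U => a ∈ U ∧ π a ∈ U ∧ b ∈ U ∧ π b ∈ U) = ∅ := by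
      intro a b hba hbπ
      refine filter_eq_empty_iff.2 fun U hU hmem => ?_
      have h4 := four_le_card_of_two_pairs_subset hπ hπ' hba hbπ hmem.1 hmem.2.1 hmem.2.2.1 hmem.2.2.2
      rw [(mem_shellIn.1 hU).2.1] at h4
      omega
    rw [hempty v w hwv hwπ, hempty v' w' hwv' hwπ', sum_empty]
  · obtain ⟨t', rfl⟩ := Nat.exists_eq_add_of_le' ht
    rw [sum_shell_pin_two_eq hπ hπ' hS H hv hw hwv hwπ t' c ψ, sum_shell_pin_two_eq hπ hπ' hS H hv' hw' hwv' hwπ' t' c ψ,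
      hσv, hσw, del2_eq_sdiff_sdiff, del2_eq_sdiff_sdiff]
    -- the first deletion
    have hS₁ := sdiff_pair_stable hπ hS v
    have hS₁' := sdiff_pair_stable hπ hS v'
    obtain ⟨hA, hB, hD⟩ := types_sdiff_pair_eq_of_type_eq hπ hπ' hS H hv hv' hσv
    -- the second deletion: `w ∈ S ∖ e_v`, `w' ∈ S ∖ e_{v'}`
    have hw₁ : w ∈ S \ {v, π v} := by
      rw [mem_sdiff, mem_insert, mem_singleton, not_or]; exact ⟨hw, hwv, hwπ⟩
    have hw₁' : w' ∈ S \ {v', π v'} := by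
      rw [mem_sdiff, mem_insert, mem_singleton, not_or]; exact ⟨hw', hwv', hwπ'⟩
    have eA := card_vAA_sdiff_pair_add hπ hπ' hS₁ H hw₁
    have eA' := card_vAA_sdiff_pair_add hπ hπ' hS₁' H hw₁'
    have eB := card_vBH_sdiff_pair_add hπ hπ' hS₁ H hw₁
    have eB' := card_vBH_sdiff_pair_add hπ hπ' hS₁' H hw₁'
    have eD := card_vDD_sdiff_pair_add hπ hπ' hS₁ H hw₁
    have eD' := card_vDD_sdiff_pair_add hπ hπ' hS₁' H hw₁'
    rw [hσw] at eA eB eD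
    exact sum_shellIn_eq_of_types_eq hπ hπ' (sdiff_pair_stable hπ hS₁ w) (sdiff_pair_stable hπ hS₁' w')
      (by omega) (by omega) (by omega) t' c (fun x => ψ (x + (({v', π v'} ∩ H).card : ℤ) + (({w', π w'} ∩ H).card : ℤ)))

/-! ### §5 The pinned pair matrix on the representatives of the edges is exchangeable within `H`-types -/

omit hπ' in
/-- Two representatives are never partners: `q ≠ πr` for `r, q ∈ reps_π(S)`. [cite: GodsilMeagher2015, §15.2] -/
theorem ne_partner_of_mem_reps {S : Finset (Fin n)} {r q : Fin n} (hr : r ∈ reps π S) (hq : q ∈ reps π S) :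
    q ≠ π r := by
  intro e
  have h1 := (mem_reps.1 hr).2
  have h2 := (mem_reps.1 hq).2
  rw [e, hπ] at h2
  exact lt_asymm h1 h2

omit hπ hπ' in
/-- The product of the two edge indicators as one indicator. [cite: Rothvoss2017, §2 (PDF p. 5)] -/
theorem pinIndicator_mul (U : Finset (Fin n)) (r q : Fin n) :
    (if (r ∈ U ∧ π r ∈ U) then (1 : ℝ) else 0) * (if (q ∈ U ∧ π q ∈ U) then (1 : ℝ) else 0) =
      if (r ∈ U ∧ π r ∈ U ∧ q ∈ U ∧ π q ∈ U) then (1 : ℝ) else 0 := by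
  by_cases h1 : r ∈ U ∧ π r ∈ U <;> by_cases h2 : q ∈ U ∧ π q ∈ U
  · rw [if_pos h1, if_pos h2, if_pos ⟨h1.1, h1.2, h2.1, h2.2⟩]; ring
  · rw [if_pos h1, if_neg h2, if_neg (show ¬(r ∈ U ∧ π r ∈ U ∧ q ∈ U ∧ π q ∈ U) from fun h => h2 ⟨h.2.2.1, h.2.2.2⟩)]; ring
  · rw [if_neg h1, if_neg (show ¬(r ∈ U ∧ π r ∈ U ∧ q ∈ U ∧ π q ∈ U) from fun h => h1 ⟨h.1, h.2.1⟩)]; ring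
  · rw [if_neg h1, if_neg (show ¬(r ∈ U ∧ π r ∈ U ∧ q ∈ U ∧ π q ∈ U) from fun h => h1 ⟨h.1, h.2.1⟩)]; ring

omit hπ hπ' in
/-- The diagonal entry of the pinned pair matrix at level `c` is the one-edge pinned sum. [cite: Rothvoss2017, §2 (PDF p. 6)] -/
theorem pinMatrix_diag_eq (S H : Finset (Fin n)) (t c : ℕ) (ψ : ℤ → ℝ) (r : Fin n) :
    ∑ U ∈ shellIn π S t c, ψ ((U ∩ H).card : ℤ) *
        ((if (r ∈ U ∧ π r ∈ U) then (1 : ℝ) else 0) * (if (r ∈ U ∧ π r ∈ U) then (1 : ℝ) else 0)) =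
      ∑ U ∈ (shellIn π S t c).filter (fun U => r ∈ U ∧ π r ∈ U), ψ ((U ∩ H).card : ℤ) := by
  rw [sum_filter]
  refine sum_congr rfl fun U _ => ?_
  by_cases h : r ∈ U ∧ π r ∈ U
  · rw [if_pos h, if_pos h]; ring
  · rw [if_neg h, if_neg h]; ring

omit hπ hπ' in
/-- The off-diagonal entry of the pinned pair matrix at level `c` is the two-edge pinned sum. [cite: Rothvoss2017, §2 (PDF p. 6)] -/
theorem pinMatrix_offDiag_eq (S H : Finset (Fin n)) (t c : ℕ) (ψ : ℤ → ℝ) (r q : Fin n) :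
    ∑ U ∈ shellIn π S t c, ψ ((U ∩ H).card : ℤ) *
        ((if (r ∈ U ∧ π r ∈ U) then (1 : ℝ) else 0) * (if (q ∈ U ∧ π q ∈ U) then (1 : ℝ) else 0)) =
      ∑ U ∈ (shellIn π S t c).filter (fun U => r ∈ U ∧ π r ∈ U ∧ q ∈ U ∧ π q ∈ U), ψ ((U ∩ H).card : ℤ) := by
  rw [sum_filter]
  refine sum_congr rfl fun U _ => ?_
  rw [pinIndicator_mul]
  by_cases h : r ∈ U ∧ π r ∈ U ∧ q ∈ U ∧ π q ∈ U
  · rw [if_pos h, if_pos h]; ring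
  · rw [if_neg h, if_neg h]; ring

/-- **EXCHANGEABILITY OF THE PINNED PAIR MATRIX, diagonal.** For a `π`-stable `S`, a block `H`, a cut size `t`, level weights
`ω` on a finite set of levels `Cs` and any `ψ`, the matrix on the vertices
`A(r,q) = Σ_{c ∈ Cs} ω_c·Σ_{U ∈ Shell_S(t,c)} ψ(|U∩H|)·[e_r ⊆ U]·[e_q ⊆ U]` has `A(r,r) = A(r',r')` whenever `r, r' ∈ S` carry edges of
the same `H`-type — the first hypothesis of `TypeSortedForm.sum_sum_mul_mul_le_typeAvg_add_of_exchangeable` with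
`τ r = |e_r ∩ H|`. [cite: Rothvoss2017, §2 (PDF pp. 5–6)] -/
theorem pinMatrix_diag_eq_of_type {S : Finset (Fin n)} (hS : ∀ u ∈ S, π u ∈ S) (H : Finset (Fin n)) (t : ℕ)
    (Cs : Finset ℕ) (ω : ℕ → ℝ) (ψ : ℤ → ℝ) {r r' : Fin n} (hr : r ∈ S) (hr' : r' ∈ S)
    (hσ : ({r, π r} ∩ H).card = ({r', π r'} ∩ H).card) :
    ∑ c ∈ Cs, ω c * ∑ U ∈ shellIn π S t c, ψ ((U ∩ H).card : ℤ) *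
        ((if (r ∈ U ∧ π r ∈ U) then (1 : ℝ) else 0) * (if (r ∈ U ∧ π r ∈ U) then (1 : ℝ) else 0)) =
      ∑ c ∈ Cs, ω c * ∑ U ∈ shellIn π S t c, ψ ((U ∩ H).card : ℤ) *
        ((if (r' ∈ U ∧ π r' ∈ U) then (1 : ℝ) else 0) * (if (r' ∈ U ∧ π r' ∈ U) then (1 : ℝ) else 0)) := by
  refine sum_congr rfl fun c _ => ?_
  rw [pinMatrix_diag_eq, pinMatrix_diag_eq, sum_shell_pinOne_eq_of_type hπ hπ' hS H hr hr' hσ t c ψ]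

/-- **EXCHANGEABILITY OF THE PINNED PAIR MATRIX, off-diagonal.** With `A` as in `pinMatrix_diag_eq_of_type`, on the
representatives `reps_π(S)` of the edges: `A(r₁,r₂) = A(r₁',r₂')` whenever `r₁ ≠ r₂`, `r₁' ≠ r₂'` and the ordered types agree,
`|e_{r₁} ∩ H| = |e_{r₁'} ∩ H|`, `|e_{r₂} ∩ H| = |e_{r₂'} ∩ H|` — the second hypothesis of
`TypeSortedForm.sum_sum_mul_mul_le_typeAvg_add_of_exchangeable` with `E = reps_π(S)`, `τ r = |e_r ∩ H|`.
[cite: Rothvoss2017, §2 (PDF pp. 5–6)] -/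
theorem pinMatrix_offDiag_eq_of_types {S : Finset (Fin n)} (hS : ∀ u ∈ S, π u ∈ S) (H : Finset (Fin n)) (t : ℕ)
    (Cs : Finset ℕ) (ω : ℕ → ℝ) (ψ : ℤ → ℝ) {r₁ r₂ r₁' r₂' : Fin n}
    (hr₁ : r₁ ∈ reps π S) (hr₂ : r₂ ∈ reps π S) (hr₁' : r₁' ∈ reps π S) (hr₂' : r₂' ∈ reps π S)
    (hne : r₁ ≠ r₂) (hne' : r₁' ≠ r₂')
    (hσ₁ : ({r₁, π r₁} ∩ H).card = ({r₁', π r₁'} ∩ H).card) (hσ₂ : ({r₂, π r₂} ∩ H).card = ({r₂', π r₂'} ∩ H).card) :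
    ∑ c ∈ Cs, ω c * ∑ U ∈ shellIn π S t c, ψ ((U ∩ H).card : ℤ) *
        ((if (r₁ ∈ U ∧ π r₁ ∈ U) then (1 : ℝ) else 0) * (if (r₂ ∈ U ∧ π r₂ ∈ U) then (1 : ℝ) else 0)) =
      ∑ c ∈ Cs, ω c * ∑ U ∈ shellIn π S t c, ψ ((U ∩ H).card : ℤ) *
        ((if (r₁' ∈ U ∧ π r₁' ∈ U) then (1 : ℝ) else 0) * (if (r₂' ∈ U ∧ π r₂' ∈ U) then (1 : ℝ) else 0)) := by
  have h₁ := reps_subset (π := π) S hr₁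
  have h₂ := reps_subset (π := π) S hr₂
  have h₁' := reps_subset (π := π) S hr₁'
  have h₂' := reps_subset (π := π) S hr₂'
  have hne₂ : r₂ ≠ π r₁ := ne_partner_of_mem_reps hπ hr₁ hr₂
  have hne₂' : r₂' ≠ π r₁' := ne_partner_of_mem_reps hπ hr₁' hr₂'
  refine sum_congr rfl fun c _ => ?_
  rw [pinMatrix_offDiag_eq, pinMatrix_offDiag_eq,
    sum_shell_pinTwo_eq_of_types hπ hπ' hS H h₁ h₂ hne.symm hne₂ h₁' h₂' hne'.symm hne₂' hσ₁ hσ₂ t c ψ]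

omit hπ in
/-- The `H`-type of an edge is one of `0, 1, 2`. [cite: Rothvoss2017, §2 (PDF p. 5)] -/
theorem card_pair_inter_mem_range (H : Finset (Fin n)) (r : Fin n) : ({r, π r} ∩ H).card ∈ range 3 := by
  rw [mem_range, card_pair_inter_eq_ite hπ' H r]
  split_ifs <;> omega

/-! ### §6 The bridge: the containment form of a general direction is a form over the representatives -/

/-- **Summation over a `π`-stable set through the representatives**: `Σ_{p ∈ S} f(p) = Σ_{r ∈ reps_π(S)} (f(r) + f(πr))`.
[cite: GodsilMeagher2015, §15.2] -/
theorem sum_eq_sum_reps_add {M : Type*} [AddCommMonoid M] {S : Finset (Fin n)} (hS : ∀ u ∈ S, π u ∈ S) (f : Fin n → M) :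
    ∑ p ∈ S, f p = ∑ r ∈ reps π S, (f r + f (π r)) := by
  have hR : ∀ v ∈ reps π S, v < π v := fun v hv => (mem_reps.1 hv).2
  have hdisj : Disjoint (reps π S) ((reps π S).image π) := by
    rw [disjoint_left]
    intro v hv hv'
    obtain ⟨w, hw, hwv⟩ := mem_image.1 hv'
    have h1 := hR v hv
    have h2 := hR w hw
    rw [← hwv, hπ] at h1
    exact lt_asymm h1 h2
  conv_lhs => rw [← close_reps hπ hπ' hS]
  rw [close, sum_union hdisj, sum_image fun a _ b _ h => π_injective hπ h, sum_add_distrib]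

/-- **The containment form of a general direction.** For a `π`-stable `S`, any vertex weights `c : Fin n → ℝ` and any cut
`U`: `Σ_{p ∈ S} c_p·x_p x_{πp} = Σ_{r ∈ reps_π(S)} (c_r + c_{πr})·[e_r ⊆ U]` (`x = 𝟙_U`): the form only sees the EDGE weights
`v_r = c_r + c_{πr}`. [cite: Rothvoss2017, §2 (PDF pp. 5–6)] -/
theorem sum_containment_eq_sum_reps {S : Finset (Fin n)} (hS : ∀ u ∈ S, π u ∈ S) (c : Fin n → ℝ) (U : Finset (Fin n)) :
    ∑ p ∈ S, c p * ((if p ∈ U then (1 : ℝ) else 0) * (if π p ∈ U then (1 : ℝ) else 0)) =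
      ∑ r ∈ reps π S, (c r + c (π r)) * (if (r ∈ U ∧ π r ∈ U) then (1 : ℝ) else 0) := by
  rw [sum_eq_sum_reps_add hπ hπ' hS]
  refine sum_congr rfl fun r _ => ?_
  rw [hπ]
  by_cases h1 : r ∈ U <;> by_cases h2 : π r ∈ U
  · rw [if_pos h1, if_pos h2, if_pos ⟨h1, h2⟩]; ring
  · rw [if_pos h1, if_neg h2, if_neg (fun h => h2 h.2)]; ring
  · rw [if_neg h1, if_pos h2, if_neg (fun h => h1 h.1)]; ring
  · rw [if_neg h1, if_neg h2, if_neg (fun h => h1 h.1)]; ring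

omit hπ hπ' in
/-- **A weighted sum of squares of a linear form in the edge indicators is a quadratic form in the pinned pair matrix**:
`Σ_{U ∈ 𝒰} ω(U)·(Σ_{r ∈ E} v_r [e_r ⊆ U])² = Σ_{r,q ∈ E} v_r v_q·(Σ_{U ∈ 𝒰} ω(U)·[e_r ⊆ U][e_q ⊆ U])`.
[cite: Rothvoss2017, §2 (PDF p. 6)] -/
theorem sum_mul_sq_sum_eq_sum_sum_pinMatrix (𝒰 : Finset (Finset (Fin n))) (ω : Finset (Fin n) → ℝ) (E : Finset (Fin n))
    (v : Fin n → ℝ) :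
    ∑ U ∈ 𝒰, ω U * (∑ r ∈ E, v r * (if (r ∈ U ∧ π r ∈ U) then (1 : ℝ) else 0)) ^ 2 =
      ∑ r ∈ E, ∑ q ∈ E, v r * v q *
        ∑ U ∈ 𝒰, ω U * ((if (r ∈ U ∧ π r ∈ U) then (1 : ℝ) else 0) * (if (q ∈ U ∧ π q ∈ U) then (1 : ℝ) else 0)) := by
  have hsq : ∀ U : Finset (Fin n), ω U * (∑ r ∈ E, v r * (if (r ∈ U ∧ π r ∈ U) then (1 : ℝ) else 0)) ^ 2 =
      ∑ r ∈ E, ∑ q ∈ E, v r * v q *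
        (ω U * ((if (r ∈ U ∧ π r ∈ U) then (1 : ℝ) else 0) * (if (q ∈ U ∧ π q ∈ U) then (1 : ℝ) else 0))) := by
    intro U
    rw [sq, sum_mul_sum, mul_sum]
    refine sum_congr rfl fun r _ => ?_
    rw [mul_sum]
    exact sum_congr rfl fun q _ => by ring
  rw [sum_congr rfl fun U _ => hsq U, sum_comm]
  refine sum_congr rfl fun r _ => ?_
  rw [sum_comm]
  refine sum_congr rfl fun q _ => ?_
  rw [mul_sum]

/-- **THE CONTAINMENT FORM OVER THE SHELLS, TYPE-SORTED INPUT.** For a `π`-stable `S`, level weights `ω` on `Cs`, any `ψ` and any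
vertex weights `c`, the weighted shell sum of `ψ(|U∩H|)·(Σ_{p∈S} c_p x_p x_{πp})²` is the quadratic form of the EDGE weights
`v_r = c_r + c_{πr}` (`r ∈ reps_π(S)`) in the pinned pair matrix of §5:
`Σ_{c∈Cs} ω_c Σ_{U ∈ Shell_S(t,c)} ψ(|U∩H|)(Σ_{p∈S} c_p x_p x_{πp})² = Σ_{r,q ∈ reps} v_r v_q·A(r,q)`. Together with §5 this places the
form under `TypeSortedForm.sum_sum_mul_mul_le_typeAvg_add_of_exchangeable` (`E = reps_π(S)`, `τ r = |e_r ∩ H| ∈ range 3`).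
[cite: Rothvoss2017, §2 (PDF pp. 5–6)] -/
theorem shellForm_eq_sum_sum_pinMatrix {S : Finset (Fin n)} (hS : ∀ u ∈ S, π u ∈ S) (H : Finset (Fin n)) (t : ℕ)
    (Cs : Finset ℕ) (ω : ℕ → ℝ) (ψ : ℤ → ℝ) (c : Fin n → ℝ) :
    ∑ k ∈ Cs, ω k * ∑ U ∈ shellIn π S t k, ψ ((U ∩ H).card : ℤ) *
        (∑ p ∈ S, c p * ((if p ∈ U then (1 : ℝ) else 0) * (if π p ∈ U then (1 : ℝ) else 0))) ^ 2 =
      ∑ r ∈ reps π S, ∑ q ∈ reps π S, (c r + c (π r)) * (c q + c (π q)) *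
        ∑ k ∈ Cs, ω k * ∑ U ∈ shellIn π S t k, ψ ((U ∩ H).card : ℤ) *
          ((if (r ∈ U ∧ π r ∈ U) then (1 : ℝ) else 0) * (if (q ∈ U ∧ π q ∈ U) then (1 : ℝ) else 0)) := by
  -- each shell sum is a weighted sum of squares of the edge form
  have hlev : ∀ k : ℕ, ω k * ∑ U ∈ shellIn π S t k, ψ ((U ∩ H).card : ℤ) *
      (∑ p ∈ S, c p * ((if p ∈ U then (1 : ℝ) else 0) * (if π p ∈ U then (1 : ℝ) else 0))) ^ 2 =
      ∑ r ∈ reps π S, ∑ q ∈ reps π S, (c r + c (π r)) * (c q + c (π q)) *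
        (ω k * ∑ U ∈ shellIn π S t k, ψ ((U ∩ H).card : ℤ) *
          ((if (r ∈ U ∧ π r ∈ U) then (1 : ℝ) else 0) * (if (q ∈ U ∧ π q ∈ U) then (1 : ℝ) else 0))) := by
    intro k
    rw [sum_congr rfl fun U _ => by rw [sum_containment_eq_sum_reps hπ hπ' hS c U],
      sum_mul_sq_sum_eq_sum_sum_pinMatrix (shellIn π S t k) (fun U => ψ ((U ∩ H).card : ℤ)) (reps π S)
        (fun r => c r + c (π r)), mul_sum]
    refine sum_congr rfl fun r _ => ?_
    rw [mul_sum]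
    refine sum_congr rfl fun q _ => ?_
    ring
  rw [sum_congr rfl fun k _ => hlev k, sum_comm]
  refine sum_congr rfl fun r _ => ?_
  rw [sum_comm]
  refine sum_congr rfl fun q _ => ?_
  rw [mul_sum]

/-! ### §7 The box-sup reduction in shell currency -/

omit hπ' in
/-- The `H`-type of an edge read at either endpoint: `|e_{πr} ∩ H| = |e_r ∩ H|`. [cite: Rothvoss2017, §2 (PDF p. 5)] -/
theorem card_pair_inter_partner (H : Finset (Fin n)) (r : Fin n) :
    ({π r, π (π r)} ∩ H).card = ({r, π r} ∩ H).card := by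
  rw [hπ, pair_comm]

/-- **THE BOX-SUP REDUCTION FOR THE CONTAINMENT FORM OF AN `H`-SYMMETRIC MASK.** Let `S` be `π`-stable, `H` a block, `t` a cut
size, `ω` level weights on `Cs`, `ψ` any function of the block statistic, and
`A(r,q) = Σ_{k∈Cs} ω_k Σ_{U ∈ Shell_S(t,k)} ψ(|U∩H|)·[e_r ⊆ U][e_q ⊆ U]` the pinned pair matrix (§5). For vertex weights `c` whose
EDGE weights are boxed, `|c_r + c_{πr}| ≤ L` on `reps_π(S)`, and numbers `D_0, D_1, D_2 ≥ 0` bounding the DIAGONAL EXCESSES,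
`A(r,r) − A(r,r') ≤ D_{|e_r ∩ H|}` for all representatives `r ≠ r'` of the same `H`-type:
`Σ_k ω_k Σ_{U∈Shell_S(t,k)} ψ(|U∩H|)(Σ_{p∈S} c_p x_p x_{πp})² ≤ Σ_k ω_k Σ_{U∈Shell_S(t,k)} ψ(|U∩H|)(Σ_{p∈S} c̄_p x_p x_{πp})² + L²·Σ_{a<3} m_a·D_a`,
where `c̄_p = ½·(Σ_{r ∈ reps, |e_r∩H| = |e_p∩H|} (c_r + c_{πr})) / m_{|e_p∩H|}` is the TYPE-CONSTANT vertex direction of the type-averaged edge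
weights (`|c̄_p| ≤ L/2` by `TypeSortedForm.abs_typeAvg_le`) and `m_a = #{r ∈ reps_π(S) : |e_r ∩ H| = a}`.
[cite: Rothvoss2017, §2 (PDF pp. 5–6)] [cite: GodsilMeagher2015, §2.2 (PDF pp. 32–33)] -/
theorem shellForm_le_typeAvg_add {S : Finset (Fin n)} (hS : ∀ u ∈ S, π u ∈ S) (H : Finset (Fin n)) (t : ℕ)
    (Cs : Finset ℕ) (ω : ℕ → ℝ) (ψ : ℤ → ℝ) (c : Fin n → ℝ) {L : ℝ}
    (hc : ∀ r ∈ reps π S, |c r + c (π r)| ≤ L) (D : ℕ → ℝ) (hD0 : ∀ a ∈ range 3, 0 ≤ D a)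
    (hD : ∀ r ∈ reps π S, ∀ r' ∈ reps π S, ({r, π r} ∩ H).card = ({r', π r'} ∩ H).card → r ≠ r' →
      (∑ k ∈ Cs, ω k * ∑ U ∈ shellIn π S t k, ψ ((U ∩ H).card : ℤ) *
          ((if (r ∈ U ∧ π r ∈ U) then (1 : ℝ) else 0) * (if (r ∈ U ∧ π r ∈ U) then (1 : ℝ) else 0))) -
        (∑ k ∈ Cs, ω k * ∑ U ∈ shellIn π S t k, ψ ((U ∩ H).card : ℤ) *
          ((if (r ∈ U ∧ π r ∈ U) then (1 : ℝ) else 0) * (if (r' ∈ U ∧ π r' ∈ U) then (1 : ℝ) else 0))) ≤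
        D (({r, π r} ∩ H).card)) :
    ∑ k ∈ Cs, ω k * ∑ U ∈ shellIn π S t k, ψ ((U ∩ H).card : ℤ) *
        (∑ p ∈ S, c p * ((if p ∈ U then (1 : ℝ) else 0) * (if π p ∈ U then (1 : ℝ) else 0))) ^ 2 ≤
      ∑ k ∈ Cs, ω k * ∑ U ∈ shellIn π S t k, ψ ((U ∩ H).card : ℤ) *
        (∑ p ∈ S, ((∑ x ∈ (reps π S).filter (fun x => ({x, π x} ∩ H).card = ({p, π p} ∩ H).card), (c x + c (π x))) /
            (((reps π S).filter (fun x => ({x, π x} ∩ H).card = ({p, π p} ∩ H).card)).card : ℝ) / 2) *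
          ((if p ∈ U then (1 : ℝ) else 0) * (if π p ∈ U then (1 : ℝ) else 0))) ^ 2 +
      L ^ 2 * ∑ a ∈ range 3, (((reps π S).filter (fun x => ({x, π x} ∩ H).card = a)).card : ℝ) * D a := by
  rw [shellForm_eq_sum_sum_pinMatrix hπ hπ' hS H t Cs ω ψ c, shellForm_eq_sum_sum_pinMatrix hπ hπ' hS H t Cs ω ψ]
  -- the type-constant vertex direction has edge weights = the type averages
  have havg : ∀ r : Fin n,
      (∑ x ∈ (reps π S).filter (fun x => ({x, π x} ∩ H).card = ({r, π r} ∩ H).card), (c x + c (π x))) /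
            (((reps π S).filter (fun x => ({x, π x} ∩ H).card = ({r, π r} ∩ H).card)).card : ℝ) / 2 +
        (∑ x ∈ (reps π S).filter (fun x => ({x, π x} ∩ H).card = ({π r, π (π r)} ∩ H).card), (c x + c (π x))) /
            (((reps π S).filter (fun x => ({x, π x} ∩ H).card = ({π r, π (π r)} ∩ H).card)).card : ℝ) / 2 =
      (∑ x ∈ (reps π S).filter (fun x => ({x, π x} ∩ H).card = ({r, π r} ∩ H).card), (c x + c (π x))) /
            (((reps π S).filter (fun x => ({x, π x} ∩ H).card = ({r, π r} ∩ H).card)).card : ℝ) := by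
    intro r
    rw [card_pair_inter_partner hπ H r]
    ring
  simp only [havg]
  exact TypeSortedForm.sum_sum_mul_mul_le_typeAvg_add_of_exchangeable (reps π S)
    (fun x => ({x, π x} ∩ H).card) (range 3) (fun r _ => card_pair_inter_mem_range hπ' H r) _
    (fun r hr r' hr' hτ => pinMatrix_diag_eq_of_type hπ hπ' hS H t Cs ω ψ (reps_subset (π := π) S hr)
      (reps_subset (π := π) S hr') hτ)
    (fun r₁ hr₁ r₂ hr₂ r₁' hr₁' r₂' hr₂' hne hne' hτ₁ hτ₂ =>
      pinMatrix_offDiag_eq_of_types hπ hπ' hS H t Cs ω ψ hr₁ hr₂ hr₁' hr₂' hne hne' hτ₁ hτ₂)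
    (fun r => c r + c (π r)) hc D hD0 hD

end ShellStep

end Literature.Combinatorics.Optimization

end
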